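import Summits.QuantumFields.YangMills.Theorems.BalabanUVNodesN08HaarCompatibilityGuardHybridPartition
import Literature.MathematicalPhysics.QuantumFieldTheory.Balaban1983to89.AveragingImageLawGaugeInvariance

/-!
# BalabanUVNodes ∕ N08 — GAUGE COVARIANCE OF THE HYBRID AVERAGING `Ū^S`: the image of any GAUGE-INVARIANT finite measure is coarse-gauge invariant, and the law of
# every single hybrid coordinate under it is EXACTLY `mass • Haar`; plus the geometry «near({c}) = {c}» below the top level

WIDTH SEAT `pub-ymgap-dag-n08-w3` g7, item-3 lineage PART 38A (successor of part 34 `…GuardHybridPartition`; consumes pub-balaban's `BlockAveraging.avgFun_covariant`,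
`AveragingRT.axialAvg_covariant` ∕ `measure_eq_mass_smul_of_invariant`, `B12RTGaugeInvariance254.{liftTransf, measurePreserving_gaugeAct}` and
`AveragingImageLawGaugeInvariance.gaugeAct_single_src∕tgt_apply` BY IMPORT), 2026-08-28.  Track A, DAG node N08 = [Balaban1985UV3] Thm 1 p. 257 (compact) + Thm 2
p. 272; key item K1⁷ `StabilityBAtRecordR13SepCoPH` (stmt-QuantumFields-20542), `--supports … --as helper`.  COUNT-NEUTRAL.

THE POINT (located; road (ii) bookkeeping, count-neutral).  The summands `(μ↾G_S)∘(Ū^S)⁻¹` of part 34's positive polymer bound inherit GAUGE INVARIANCE from their input: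
the hybrid averaging is gauge COVARIANT exactly like print's (`Ū^S(U^u) = (Ū^S U)^{u∘emb}`, §1), so a gauge-invariant input measure has a coarse-gauge-invariant image (§2,
[Balaban1987RG1] p. 265 «the δ-functions in (2.1) are invariant under the gauge transformations V → V^v»), and therefore the law of ANY ONE hybrid coordinate `Ū^S(·)(c)` under
it is two-sided translation invariant, i.e. EXACTLY `μ(univ) • Haar` (§3, Weil uniqueness).  §4 is the lattice fact that below the top level (`j + 1 < m + K`, i.e. more than two
coarse sites per direction) the only coarse bond with both end points among `{c₋, c₊}` is `c` itself — so in part 37's canonical far set of `S = {c}` the near set is `{c}` ALONE;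
part 38B combines §3 + §4 + part 35's product form into «an isolated guarded bond leaves no trace at the next level».

* §1 `hybrid_gaugeAct`, `hybrid_gaugeAct_liftTransf` (covariance).
* §2 `map_withDensity_eq_of_invariant` ([folklore]: a density invariant under a measure-preserving bijection gives an invariant weighted measure), `gaugeInvariant_mul_guardAll_indicator`
  (`ρ·1_{G_S}` is gauge invariant with `ρ`), ★ `map_gaugeAct_map_hybrid` (the image of a gauge-invariant measure under `Ū^S` is coarse-gauge invariant).
* §3 ★★ `map_apply_hybrid_eq_mass_smul_haar` — **`μ∘(Ū^S(·)(c))⁻¹ = μ(univ) • Haar`** for every gauge-invariant finite `μ`, every `S`, every `c`.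
* §4 `two_lt_sitesPerDir`, `shift_injective_dir`, `shift_shift_ne_self` (with the tree's `B12SmallFieldDomain259.src_ne_tgt`), ★ `eq_of_src_mem_of_tgt_mem` (near({c}) = {c} below the top level).

HONEST FRAMING.  [folklore] over landed modules; nothing of Bałaban's asserted; no density bound, no cluster expansion, no k-uniform `hmass`; E6′ NOT decided; N08 NOT discharged; counts
unmoved (typed 28∕28 · discharged 5∕27); one finite 𝕋⁴ programme at fixed ε — R4 closes the CONDITIONAL rung `BalabanLadder.UV` only; the Yang–Mills mass gap (Clay) is NOT proved by any of
this; nothing continuum ∕ ℝ⁴ ∕ OS.  0 `sorry`, 0 `def`, 0 `instance`, standard axioms.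
-/

noncomputable section

open MeasureTheory
open scoped ENNReal

namespace Summit.QuantumFields.YangMills.BalabanUVNodes.N08HaarCompatibilityGuardHybridCovariance

open Literature.MathematicalPhysics.QuantumFieldTheory.Balaban1983to89
open Literature.MathematicalPhysics.QuantumFieldTheory.Balaban1983to89.AveragingRT (axialAvg measurable_axialAvg axialAvg_covariant measure_eq_mass_smul_of_invariant)
open Literature.MathematicalPhysics.QuantumFieldTheory.Balaban1983to89.BlockAveraging (Small avgFun measurable_avgFun avgFun_covariant small_gaugeAct_iff)
open Literature.MathematicalPhysics.QuantumFieldTheory.Balaban1983to89.B12RTGaugeInvariance254 (liftTransf liftTransf_comp_emb measurable_gaugeAct measurePreserving_gaugeAct)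
open Literature.MathematicalPhysics.QuantumFieldTheory.Balaban1983to89.AveragingImageLawGaugeInvariance (gaugeAct_single_src_apply gaugeAct_single_tgt_apply)
open Summit.QuantumFields.YangMills.BalabanUVNodes.N08HaarCompatibilityGuardHybridPartition (measurable_hybrid measurableSet_guardAll)

/-! ## §1 Gauge covariance of the hybrid averaging -/

section Covariance

variable {P : Params} {j : ℕ} {G : Type*} [GaugeGroup G] (ℰ : LoopAverage G) [DecidableEq (PBond P (j + 1))]

/-- **COVARIANCE `Ū^S(U^u) = (Ū^S U)^{u∘emb}`** of the hybrid averaging, bond by bond from pub-balaban's `avgFun_covariant` (on `S`) and `axialAvg_covariant` (off `S`); standing range.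
[cite: Balaban1985Averaging, (11) p.19] -/
theorem hybrid_gaugeAct (hj : j + 1 ≤ P.m + P.K) (S : Finset (PBond P (j + 1))) (u : GaugeTransf P j G) (U : GaugeField P j G) :
    (fun c => if c ∈ S then avgFun ℰ (GaugeField.gaugeAct u U) c else axialAvg (GaugeField.gaugeAct u U) c : GaugeField P (j + 1) G) =
      GaugeField.gaugeAct (fun y => u (emb y)) (fun c => if c ∈ S then avgFun ℰ U c else axialAvg U c) := by
  funext c
  show (if c ∈ S then avgFun ℰ (GaugeField.gaugeAct u U) c else axialAvg (GaugeField.gaugeAct u U) c) =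
    u (emb c.src) * (if c ∈ S then avgFun ℰ U c else axialAvg U c) * (u (emb c.tgt))⁻¹
  by_cases hc : c ∈ S
  · rw [if_pos hc, if_pos hc, avgFun_covariant ℰ hj u U]; rfl
  · rw [if_neg hc, if_neg hc, axialAvg_covariant hj u U]; rfl

/-- **`Ū^S(U^{v∘blockOf}) = (Ū^S U)^v`** for every COARSE gauge transformation `v` (its block-constant lift, [Balaban1987RG1] p. 265). [cite: Balaban1987RG1, (2.1) p.265] -/
theorem hybrid_gaugeAct_liftTransf (hj : j + 1 ≤ P.m + P.K) (S : Finset (PBond P (j + 1))) (v : GaugeTransf P (j + 1) G) (U : GaugeField P j G) :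
    (fun c => if c ∈ S then avgFun ℰ (GaugeField.gaugeAct (liftTransf v) U) c else axialAvg (GaugeField.gaugeAct (liftTransf v) U) c : GaugeField P (j + 1) G) =
      GaugeField.gaugeAct v (fun c => if c ∈ S then avgFun ℰ U c else axialAvg U c) := by
  rw [hybrid_gaugeAct ℰ hj S (liftTransf v) U, liftTransf_comp_emb hj]

end Covariance

/-! ## §2 The image of a gauge-invariant measure under `Ū^S` is coarse-gauge invariant -/

section Invariance

variable {P : Params} {j : ℕ} {G : Type*} [GaugeGroup G] (ℰ : LoopAverage G) [MeasurableSpace G] [RegularGaugeGroup G] [HaarData G]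

omit [RegularGaugeGroup G] [HaarData G] in
/-- [folklore] **An invariant density weights an invariant measure invariantly**: if `g` preserves `μ` and `ρ ∘ g = ρ`, then `(ρ·μ)∘g⁻¹ = ρ·μ` (for `ℝ≥0∞`-valued `ρ`). [folklore] -/
theorem map_withDensity_eq_of_invariant {X : Type*} [MeasurableSpace X] {μ : Measure X} {g : X → X} (hg : MeasurePreserving g μ μ) (ρ : X → ℝ≥0∞)
    (hρm : Measurable ρ) (hρ : ∀ x, ρ (g x) = ρ x) : (μ.withDensity ρ).map g = μ.withDensity ρ := by
  ext A hA
  rw [Measure.map_apply hg.measurable hA, withDensity_apply _ (hg.measurable hA), withDensity_apply _ hA, ← lintegral_indicator hA,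
    ← lintegral_indicator (hg.measurable hA)]
  have h1 : (fun x => (g ⁻¹' A).indicator ρ x) = fun x => A.indicator ρ (g x) := by
    funext x
    by_cases hx : g x ∈ A
    · rw [Set.indicator_of_mem (show x ∈ g ⁻¹' A from hx), Set.indicator_of_mem hx, hρ x]
    · rw [Set.indicator_of_notMem (show x ∉ g ⁻¹' A from hx), Set.indicator_of_notMem hx]
  rw [h1]
  exact hg.lintegral_comp (hρm.indicator hA)

omit [MeasurableSpace G] [RegularGaugeGroup G] [HaarData G] in
/-- **`ρ·1_{G_S}` IS GAUGE INVARIANT WITH `ρ`** (the small-field events are gauge invariant, `small_gaugeAct_iff`). [cite: Balaban1987RG1, (0.4) p.253 (bookkeeping)] -/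
theorem gaugeInvariant_mul_guardAll_indicator (S : Finset (PBond P (j + 1))) {ρ : GaugeField P j G → ℝ} (hρ : GaugeField.GaugeInvariant ρ) :
    GaugeField.GaugeInvariant fun U : GaugeField P j G => ρ U * {W : GaugeField P j G | ∀ c ∈ S, Small ℰ W c}.indicator (fun _ => (1 : ℝ)) U := by
  intro u U
  have h : (GaugeField.gaugeAct u U ∈ {W : GaugeField P j G | ∀ c ∈ S, Small ℰ W c}) ↔ (U ∈ {W : GaugeField P j G | ∀ c ∈ S, Small ℰ W c}) :=
    forall₂_congr fun c _ => small_gaugeAct_iff ℰ u U c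
  show ρ (GaugeField.gaugeAct u U) * _ = ρ U * _
  rw [hρ u U]
  by_cases hU : U ∈ {W : GaugeField P j G | ∀ c ∈ S, Small ℰ W c}
  · rw [Set.indicator_of_mem hU, Set.indicator_of_mem (h.2 hU)]
  · rw [Set.indicator_of_notMem hU, Set.indicator_of_notMem (fun h' => hU (h.1 h'))]

omit [RegularGaugeGroup G] in
/-- **A GAUGE-INVARIANT NON-NEGATIVE DENSITY GIVES A GAUGE-INVARIANT MEASURE `ρ·dU`** (`dU` is gauge invariant: `measurePreserving_gaugeAct`). [cite: Balaban1985Averaging, (10)+(12) p.19] -/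
theorem map_gaugeAct_withDensity_of_gaugeInvariant [MeasurableMul₂ G] {ρ : GaugeField P j G → ℝ} (hρm : Measurable ρ) (hρ : GaugeField.GaugeInvariant ρ)
    (u : GaugeTransf P j G) :
    ((fieldMeasure P j G).withDensity fun U => ENNReal.ofReal (ρ U)).map (GaugeField.gaugeAct u) = (fieldMeasure P j G).withDensity fun U => ENNReal.ofReal (ρ U) :=
  map_withDensity_eq_of_invariant (measurePreserving_gaugeAct u) _ hρm.ennreal_ofReal fun U => by simp only [hρ u U]

variable [DecidableEq (PBond P (j + 1))]

omit [HaarData G] in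
/-- ★ **THE IMAGE OF A GAUGE-INVARIANT MEASURE UNDER THE HYBRID AVERAGING IS COARSE-GAUGE INVARIANT**: if `μ∘(·)^u⁻¹ = μ` for every fine gauge transformation `u`, then
`(μ∘(Ū^S)⁻¹)∘(·)^v⁻¹ = μ∘(Ū^S)⁻¹` for every coarse `v` (covariance §1 + `μ` absorbs the block-constant lift). [cite: Balaban1987RG1, (2.1) p.265; Balaban1985Averaging, (11) p.19] -/
theorem map_gaugeAct_map_hybrid (hj : j + 1 ≤ P.m + P.K) (hE : ∀ n, Measurable fun W : Fin (n + 1) → G => ℰ.E W) (S : Finset (PBond P (j + 1)))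
    (μ : Measure (GaugeField P j G)) (hμ : ∀ u : GaugeTransf P j G, μ.map (GaugeField.gaugeAct u) = μ) (v : GaugeTransf P (j + 1) G) :
    (μ.map (fun U => (fun c => if c ∈ S then avgFun ℰ U c else axialAvg U c : GaugeField P (j + 1) G))).map (GaugeField.gaugeAct v) =
      μ.map (fun U => (fun c => if c ∈ S then avgFun ℰ U c else axialAvg U c : GaugeField P (j + 1) G)) := by
  have hcomp : (GaugeField.gaugeAct v ∘ fun U => (fun c => if c ∈ S then avgFun ℰ U c else axialAvg U c : GaugeField P (j + 1) G)) =
      (fun U => (fun c => if c ∈ S then avgFun ℰ U c else axialAvg U c : GaugeField P (j + 1) G)) ∘ GaugeField.gaugeAct (liftTransf v) := by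
    funext U
    simp only [Function.comp_apply]
    exact (hybrid_gaugeAct_liftTransf ℰ hj S v U).symm
  calc (μ.map (fun U => (fun c => if c ∈ S then avgFun ℰ U c else axialAvg U c : GaugeField P (j + 1) G))).map (GaugeField.gaugeAct v)
      = μ.map (GaugeField.gaugeAct v ∘ fun U => (fun c => if c ∈ S then avgFun ℰ U c else axialAvg U c : GaugeField P (j + 1) G)) :=
        Measure.map_map (measurable_gaugeAct v) (measurable_hybrid ℰ hE S)
    _ = μ.map ((fun U => (fun c => if c ∈ S then avgFun ℰ U c else axialAvg U c : GaugeField P (j + 1) G)) ∘ GaugeField.gaugeAct (liftTransf v)) :=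
        congrArg (fun F : GaugeField P j G → GaugeField P (j + 1) G => μ.map F) hcomp
    _ = (μ.map (GaugeField.gaugeAct (liftTransf v))).map (fun U => (fun c => if c ∈ S then avgFun ℰ U c else axialAvg U c : GaugeField P (j + 1) G)) :=
        (Measure.map_map (measurable_hybrid ℰ hE S) (measurable_gaugeAct _)).symm
    _ = _ := by rw [hμ]

/-! ## §3 The law of one hybrid coordinate under a gauge-invariant measure is `mass • Haar` -/

/-- ★★ **THE LAW OF A SINGLE HYBRID COORDINATE UNDER A GAUGE-INVARIANT FINITE MEASURE IS EXACTLY `μ(univ) • Haar`**: the coarse gauge transformations concentrated at `c₊`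
(resp. `c₋`) translate `Ū^S(·)(c)` on the right (resp. left), so by §2 its law is right-invariant, hence (Weil uniqueness against the left-invariant Haar probability,
`AveragingRT.measure_eq_mass_smul_of_invariant`) equal to its mass times Haar — every `S`, every `c` (guarded or not), every gauge-invariant finite input.
[cite: Balaban1987RG1, (2.1) p.265; Balaban1985Averaging, (10)+(11) p.19] -/
theorem map_apply_hybrid_eq_mass_smul_haar (hj : j + 1 ≤ P.m + P.K) (hE : ∀ n, Measurable fun W : Fin (n + 1) → G => ℰ.E W) (S : Finset (PBond P (j + 1)))
    (μ : Measure (GaugeField P j G)) [IsFiniteMeasure μ] (hμ : ∀ u : GaugeTransf P j G, μ.map (GaugeField.gaugeAct u) = μ) (c : PBond P (j + 1)) :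
    μ.map (fun U => (if c ∈ S then avgFun ℰ U c else axialAvg U c)) = μ Set.univ • (HaarData.haar : Measure G) := by
  haveI := HaarData.isProb (G := G)
  have hcm : Measurable fun U : GaugeField P j G => (if c ∈ S then avgFun ℰ U c else axialAvg U c) :=
    (measurable_pi_apply c).comp (measurable_hybrid ℰ hE S)
  haveI : IsFiniteMeasure (μ.map (fun U => (if c ∈ S then avgFun ℰ U c else axialAvg U c))) := Measure.isFiniteMeasure_map _ _
  -- right invariance from the fine gauge transformation lifting `g⁻¹` at `c₊`
  have hright : ∀ g : G, (μ.map (fun U => (if c ∈ S then avgFun ℰ U c else axialAvg U c))).map (fun h => h * g) =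
      μ.map (fun U => (if c ∈ S then avgFun ℰ U c else axialAvg U c)) := by
    intro g
    have key : ∀ U : GaugeField P j G,
        (if c ∈ S then avgFun ℰ (GaugeField.gaugeAct (liftTransf fun y => by classical exact if y = c.tgt then g⁻¹ else 1) U) c
          else axialAvg (GaugeField.gaugeAct (liftTransf fun y => by classical exact if y = c.tgt then g⁻¹ else 1) U) c) =
        (if c ∈ S then avgFun ℰ U c else axialAvg U c) * g := by
      intro U
      have h1 := congrFun (hybrid_gaugeAct_liftTransf ℰ hj S (fun y => by classical exact if y = c.tgt then g⁻¹ else 1) U) c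
      beta_reduce at h1
      rw [h1, gaugeAct_single_tgt_apply c g]
    have hcomp : ((fun h : G => h * g) ∘ fun U : GaugeField P j G => (if c ∈ S then avgFun ℰ U c else axialAvg U c)) =
        (fun U : GaugeField P j G => (if c ∈ S then avgFun ℰ U c else axialAvg U c)) ∘
          GaugeField.gaugeAct (liftTransf fun y => by classical exact if y = c.tgt then g⁻¹ else 1) := by
      funext U
      simp only [Function.comp_apply]
      exact (key U).symm
    calc (μ.map (fun U => (if c ∈ S then avgFun ℰ U c else axialAvg U c))).map (fun h => h * g)
        = μ.map ((fun h : G => h * g) ∘ fun U : GaugeField P j G => (if c ∈ S then avgFun ℰ U c else axialAvg U c)) :=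
          Measure.map_map (measurable_mul_const g) hcm
      _ = μ.map ((fun U : GaugeField P j G => (if c ∈ S then avgFun ℰ U c else axialAvg U c)) ∘
            GaugeField.gaugeAct (liftTransf fun y => by classical exact if y = c.tgt then g⁻¹ else 1)) := congrArg (fun F : GaugeField P j G → G => μ.map F) hcomp
      _ = (μ.map (GaugeField.gaugeAct (liftTransf fun y => by classical exact if y = c.tgt then g⁻¹ else 1))).map
            (fun U : GaugeField P j G => (if c ∈ S then avgFun ℰ U c else axialAvg U c)) := (Measure.map_map hcm (measurable_gaugeAct _)).symm
      _ = _ := by rw [hμ]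
  have h := measure_eq_mass_smul_of_invariant (HaarData.haar : Measure G) (μ.map (fun U => (if c ∈ S then avgFun ℰ U c else axialAvg U c)))
    HaarData.map_mul_left hright
  rw [h, Measure.map_apply hcm MeasurableSet.univ, Set.preimage_univ]

end Invariance

/-! ## §4 Geometry: below the top level the only bond with both end points in `{c₋, c₊}` is `c` -/

section Geometry

variable {P : Params} {j : ℕ}

/-- Below the top level every torus direction has MORE than two coarse sites: `j + 1 < m + K ⇒ 2 < 2·L^{m+K−(j+1)}`. [cite: Balaban1987RG1, (0.1) p.251] -/
theorem two_lt_sitesPerDir (h : j + 1 < P.m + P.K) : 2 < P.sitesPerDir (j + 1) := by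
  unfold Params.sitesPerDir
  have hL : 1 < P.L := P.hL.2
  have hexp : 1 ≤ P.m + P.K - (j + 1) := by omega
  have : P.L ≤ P.L ^ (P.m + P.K - (j + 1)) := by
    calc P.L = P.L ^ 1 := (pow_one _).symm
      _ ≤ P.L ^ (P.m + P.K - (j + 1)) := Nat.pow_le_pow_right (by omega) hexp
  omega

/-- `x + e_μ = x + e_ν ⇒ μ = ν`. [folklore] -/
theorem shift_injective_dir (x : Site P (j + 1)) {μ ν : Fin P.d} (h : x.shift μ = x.shift ν) : μ = ν := by
  by_contra hne
  have h1 := congrFun h μ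
  simp only [Site.shift, Function.update_self, Function.update_of_ne hne] at h1
  exact B12SmallFieldDomain259.src_ne_tgt (⟨x, μ⟩ : PBond P (j + 1)) (Eq.symm (by
    funext κ
    by_cases hκ : κ = μ
    · subst hκ; simp only [PBond.tgt, Site.shift, Function.update_self]; exact h1
    · simp only [PBond.tgt, Site.shift, Function.update_of_ne hκ]))

/-- `x + e_μ + e_ν ≠ x` below the top level (more than two sites per direction). [cite: Balaban1987RG1, (0.1) p.251] -/
theorem shift_shift_ne_self (h : j + 1 < P.m + P.K) (x : Site P (j + 1)) (μ ν : Fin P.d) : (x.shift μ).shift ν ≠ x := by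
  intro heq
  have h2 := two_lt_sitesPerDir (P := P) h
  by_cases hμν : ν = μ
  · subst hμν
    have h1 := congrFun heq ν
    simp only [Site.shift, Function.update_self] at h1
    have h3 : (2 : ZMod (P.sitesPerDir (j + 1))) = 0 := by
      calc (2 : ZMod (P.sitesPerDir (j + 1))) = (x ν + 1 + 1) - x ν := by ring
        _ = 0 := by rw [h1, sub_self]
    have h4 : ((2 : ℕ) : ZMod (P.sitesPerDir (j + 1))) = 0 := by exact_mod_cast h3
    rw [ZMod.natCast_eq_zero_iff] at h4
    exact absurd (Nat.le_of_dvd (by norm_num) h4) (by omega)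
  · have h1 := congrFun heq μ
    simp only [Site.shift, Function.update_self, Function.update_of_ne (Ne.symm hμν), Function.update_of_ne hμν] at h1
    have h3 : (1 : ZMod (P.sitesPerDir (j + 1))) = 0 := by
      calc (1 : ZMod (P.sitesPerDir (j + 1))) = (x μ + 1) - x μ := by ring
        _ = 0 := by rw [h1, sub_self]
    exact one_ne_zero h3

/-- ★ **BELOW THE TOP LEVEL THE ONLY COARSE BOND WITH BOTH END POINTS AMONG `{c₋, c₊}` IS `c`** — so in part 37's canonical far set of `S = {c}` the near set is `{c}` alone.
[cite: Balaban1987RG1, (0.1) p.251 (bookkeeping)] -/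
theorem eq_of_src_mem_of_tgt_mem (h : j + 1 < P.m + P.K) {c c' : PBond P (j + 1)} (hs : c'.src = c.src ∨ c'.src = c.tgt) (ht : c'.tgt = c.src ∨ c'.tgt = c.tgt) :
    c' = c := by
  rcases hs with hs | hs
  · rcases ht with ht | ht
    · exact absurd (ht.trans hs.symm).symm (B12SmallFieldDomain259.src_ne_tgt c')
    · have h1 : c.src.shift c'.dir = c.src.shift c.dir := by
        have h2 : c'.src.shift c'.dir = c.src.shift c.dir := ht
        rwa [hs] at h2
      exact B12SmallFieldDomain259.bond_eq_of_src_eq_of_tgt_eq hs ht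
  · rcases ht with ht | ht
    · have h1 : (c.src.shift c.dir).shift c'.dir = c.src := by
        have h2 : c'.src.shift c'.dir = c.src := ht
        rwa [hs] at h2
      exact absurd h1 (shift_shift_ne_self h c.src c.dir c'.dir)
    · exact absurd (ht.trans hs.symm).symm (B12SmallFieldDomain259.src_ne_tgt c')

end Geometry

end Summit.QuantumFields.YangMills.BalabanUVNodes.N08HaarCompatibilityGuardHybridCovariance

end
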